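import Literature.NumberTheory.Automorphic.HeckeTransversalGL
import Literature.NumberTheory.Automorphic.ParabolicGL
import Literature.NumberTheory.Automorphic.LinearAlgebraicGroups
import HarnessLib

/-!
# The Iwasawa decomposition `GL_n(F) = B(F) · GL_n(𝒪) = U · ϖ^{ℤⁿ} · GL_n(𝒪)`

Topic `NumberTheory/Automorphic`; namespace `Literature.Automorphic`. Everything here is proved, over the
tree's notions `glInt n F = GL_n(𝒪)` (`ReductiveGroupData`; `𝒪 = 𝒪[F]` the valuation ring of a
field `F` with a `ValuativeRel`), `standardParabolicGL F id = B(F)` (invertible upper triangular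
matrices) and `upperUnitriangular (Fin n) F = U_n(F)` (`ParabolicGL`), `diagonalGL`
(`LinearAlgebraicGroups`), and `IsUniformizingElement`, `IsIntegralMatrix`,
`mem_glInt_of_isIntegralMatrix`, `permGL`, `piPowGL` of `HeckeTransversalGL`.

* `exists_borel_mul_glInt` (**Iwasawa decomposition**, Bump 1997, Prop. 4.5.2): every
  `g ∈ GL_n(F)` is `g = b k` with `b ∈ B(F)` and `k ∈ GL_n(𝒪)` — for the valuation ring of *any*
  valuative relation on any field (no discreteness, completeness or finiteness is used).
* `exists_unipotent_mul_diagonal_mul_glInt`: `g = u · diag(d) · k`, `u ∈ U_n(F)`, `d ∈ (Fˣ)ⁿ`,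
  `k ∈ GL_n(𝒪)` (`B = U · A`, `mul_diagonalGL_inv_mem_upperUnitriangular`).
* `exists_unipotent_mul_zpowDiagGL_mul_glInt`: if `𝒪` is a discrete valuation ring (instance
  hypothesis `[IsDiscreteValuationRing 𝒪[F]]`, automatic for a non-archimedean local field) and `ϖ`
  is a uniformizing element, `g = u · ϖ^m · k` with `m ∈ ℤⁿ`, `ϖ^m = diag(ϖ^{m_1}, …, ϖ^{m_n})`
  (`zpowDiagGL`; `= piPowGL` of `HeckeTransversalGL` for `m ∈ ℕⁿ`, `zpowDiagGL_natCast`), via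
  `exists_eq_zpow_mul_of_ne_zero` (`x = ϖ^a e`, `|e| = 1`, from Mathlib's
  `IsDiscreteValuationRing.eq_unit_mul_pow_irreducible`).
* `zpowDiagGL_unique` (**uniqueness of the torus part**): `u ϖ^m k = u' ϖ^{m'} k'` forces
  `m = m'` — the upper triangular matrix `(u ϖ^m)⁻¹ (u' ϖ^{m'}) = k k'⁻¹ ∈ GL_n(𝒪)` has diagonal
  `ϖ^{m' - m}`, its inverse `ϖ^{m - m'}`, and both are integral only if `m = m'`
  (`IsUniformizingElement.eq_zero_of_zpow_mem`). So `U_n(F) \ GL_n(F) / GL_n(𝒪) ↔ ℤⁿ`, the index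
  set of the torus sums in the unramified computations (`ShintaniWhittakerFormula`).

## Proof of the decomposition (Bump 1997, Prop. 4.5.2, by column operations)

`IsRowTriangularFrom M i₀` says that the rows `≥ i₀` of `M` are upper triangular. The
*elimination step* `exists_mul_glInt_isRowTriangularFrom` passes from `i₀ + 1` to `i₀`: among
`g_{i₀ 0}, …, g_{i₀ i₀}` pick an entry `p = g_{i₀ j₀}` of maximal valuation; `p ≠ 0`, for otherwise
the `n - i₀` rows `≥ i₀` would be supported in the `n - i₀ - 1` columns `> i₀` and `det g = 0`
(`det_eq_zero_of_rows_supported`, a dimension count with `LinearMap.ker_ne_bot_of_finrank_lt` and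
`Matrix.exists_vecMul_eq_zero_iff`); swap the columns `j₀`, `i₀` (`permGL`, in `GL_n(𝒪)`) and
subtract `g_{i₀ b}/p` times the column `i₀` from the column `b < i₀` (`rowClearGL`, a lower
unitriangular matrix with entries `g_{i₀ b}/p ∈ 𝒪` by maximality, in `GL_n(𝒪)` by
`mem_glInt_of_isIntegralMatrix`); these operations only involve the columns `≤ i₀`, on which
the rows `> i₀` vanish, so those rows stay triangular. Induction on `i₀` from `n` down to `0`
(`exists_mul_glInt_blockTriangular_of_isRowTriangularFrom`).

## References

* D. Bump, *Automorphic Forms and Representations*, Cambridge Studies in Advanced Mathematics 55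
  (1997), Prop. 4.5.2 (Iwasawa decomposition `GL(n, F) = B(F) K` for a non-archimedean local
  field, same proof).
* P. Garrett, *Modern Analysis of Automorphic Forms by Example* (2018), §1.3, §2.1 (Iwasawa
  decompositions `G = PK = NA⁺K`, injectivity of `N × A⁺ × K → G` in the archimedean case).
-/

noncomputable section

/-! ## The Iwasawa decomposition `GL_n(F) = B(F) · GL_n(𝒪)` -/

namespace Literature.NumberTheory.Automorphic

open ValuativeRel Matrix Finset

variable {F : Type*} [Field F] [ValuativeRel F] {n : ℕ}

/-! ### Upper triangularity of the bottom rows -/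

/-- `M` is upper triangular in the rows of index `≥ i₀`: `M i j = 0` for `i ≥ i₀` and `j < i`.
[folklore] -/
def IsRowTriangularFrom (M : Matrix (Fin n) (Fin n) F) (i₀ : ℕ) : Prop :=
  ∀ i j : Fin n, i₀ ≤ (i : ℕ) → j < i → M i j = 0

omit [ValuativeRel F] in
/-- Vacuous from row `n` on. [folklore] -/
theorem isRowTriangularFrom_of_le {M : Matrix (Fin n) (Fin n) F} {i₀ : ℕ} (hn : n ≤ i₀) :
    IsRowTriangularFrom M i₀ :=
  fun i _ hi _ => absurd (lt_of_lt_of_le i.is_lt (hn.trans hi)) (lt_irrefl _)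

omit [ValuativeRel F] in
/-- From row `0` on it is upper triangularity (Mathlib's `BlockTriangular id`). [folklore] -/
theorem isRowTriangularFrom_zero_iff {M : Matrix (Fin n) (Fin n) F} :
    IsRowTriangularFrom M 0 ↔ M.BlockTriangular id :=
  ⟨fun h _ _ hij => h _ _ (Nat.zero_le _) hij, fun h _ _ _ hij => h hij⟩

/-! ### A determinant criterion -/

omit [ValuativeRel F] in
/-- If the rows `i ≥ i₀` of `M` are supported in the columns `j > i₀` then `det M = 0`
(`n - i₀` rows in an `(n - i₀ - 1)`-dimensional coordinate subspace are linearly dependent).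
[folklore] -/
theorem det_eq_zero_of_rows_supported {M : Matrix (Fin n) (Fin n) F} (i₀ : Fin n)
    (h : ∀ i j : Fin n, i₀ ≤ i → j ≤ i₀ → M i j = 0) : M.det = 0 := by
  classical
  set T : Finset (Fin n) := Finset.Ici i₀ with hT
  set U : Finset (Fin n) := Finset.Ioi i₀ with hU
  set N : Matrix T U F := M.submatrix Subtype.val Subtype.val with hN
  have hcard : Module.finrank F (U → F) < Module.finrank F (T → F) := by
    rw [Module.finrank_fintype_fun_eq_card, Module.finrank_fintype_fun_eq_card,
      Fintype.card_coe, Fintype.card_coe, hT, hU, Fin.card_Ici, Fin.card_Ioi]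
    have := i₀.is_lt
    omega
  have hker := LinearMap.ker_ne_bot_of_finrank_lt (f := Matrix.vecMulLinear N) hcard
  rw [Ne, Submodule.eq_bot_iff, not_forall] at hker
  obtain ⟨w₀, hw₀⟩ := hker
  rw [Classical.not_imp] at hw₀
  obtain ⟨hw₀ker, hw₀ne⟩ := hw₀
  rw [LinearMap.mem_ker, Matrix.coe_vecMulLinear] at hw₀ker
  -- extend `w₀` by zero
  let w : Fin n → F := fun i => if hi : i₀ ≤ i then w₀ ⟨i, Finset.mem_Ici.mpr hi⟩ else 0
  have hw : w ≠ 0 := by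
    obtain ⟨x, hx⟩ := Function.ne_iff.mp hw₀ne
    refine Function.ne_iff.mpr ⟨x.1, ?_⟩
    have hx0 : i₀ ≤ x.1 := Finset.mem_Ici.mp x.2
    simp only [w, dif_pos hx0, Pi.zero_apply]
    exact hx
  refine Matrix.exists_vecMul_eq_zero_iff.mp ⟨w, hw, ?_⟩
  funext j
  simp only [Matrix.vecMul, dotProduct, Pi.zero_apply]
  by_cases hj : i₀ < j
  · -- `j ∈ U`: the kernel condition
    have := congrFun hw₀ker ⟨j, Finset.mem_Ioi.mpr hj⟩
    simp only [Matrix.vecMul, dotProduct, Pi.zero_apply, hN, Matrix.submatrix_apply] at this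
    have hL : ∑ i, w i * M i j = ∑ x : T, w (x : Fin n) * M x j := by
      rw [Finset.sum_coe_sort T (fun i => w i * M i j)]
      exact (Finset.sum_subset (Finset.subset_univ T) (fun i _ hi => by
        have hi' : ¬ i₀ ≤ i := fun h' => hi (Finset.mem_Ici.mpr h')
        simp only [w, dif_neg hi', zero_mul])).symm
    rw [hL]
    refine Eq.trans (Finset.sum_congr rfl fun x _ => ?_) this
    have hx : i₀ ≤ (x : Fin n) := Finset.mem_Ici.mp x.2
    simp only [w, dif_pos hx]
  · refine Finset.sum_eq_zero fun i _ => ?_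
    by_cases hi : i₀ ≤ i
    · rw [h i j hi (not_lt.mp hj), mul_zero]
    · simp only [w, dif_neg hi, zero_mul]

/-! ### Column operations in `GL_n(𝒪)` -/

omit [ValuativeRel F] in
/-- Right multiplication by a permutation matrix permutes the columns:
`(M P_σ)_{ab} = M_{a, σ⁻¹ b}`. [folklore] -/
theorem mul_permMatrix_apply (M : Matrix (Fin n) (Fin n) F) (σ : Equiv.Perm (Fin n))
    (a b : Fin n) : (M * σ.permMatrix F) a b = M a (σ.symm b) := by
  rw [Matrix.mul_apply, Finset.sum_eq_single (σ.symm b)]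
  · rw [permMatrix_apply', if_pos (Equiv.apply_symm_apply σ b), mul_one]
  · intro l _ hl
    rw [permMatrix_apply', if_neg, mul_zero]
    intro h; apply hl; rw [← h, Equiv.symm_apply_apply]
  · intro h; exact absurd (Finset.mem_univ _) h

omit [ValuativeRel F] in
/-- The lower unitriangular matrix `1 - ∑_{b < i₀} c_b E_{i₀ b}`: right multiplication by it
subtracts `c_b` times the column `i₀` from the column `b`, for every `b < i₀`. [folklore] -/
def rowClearMatrix (i₀ : Fin n) (c : Fin n → F) : Matrix (Fin n) (Fin n) F :=
  fun a b => if a = b then 1 else if a = i₀ ∧ b < i₀ then -c b else 0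

omit [ValuativeRel F] in
/-- `rowClearMatrix i₀ c = 1 - ∑_{b < i₀} c_b E_{i₀ b}` entrywise. [folklore] -/
theorem rowClearMatrix_apply (i₀ : Fin n) (c : Fin n → F) (a b : Fin n) :
    rowClearMatrix i₀ c a b =
      (if a = b then 1 else 0) + (if a = i₀ ∧ b < i₀ then -c b else 0) := by
  unfold rowClearMatrix
  split_ifs with h1 h2
  · exact absurd (h1.symm.trans h2.1 ▸ h2.2) (lt_irrefl _)
  · rw [add_zero]
  · rw [zero_add]
  · rw [add_zero]

omit [ValuativeRel F] in
/-- `(M R)_{ab} = M_{ab} - [b < i₀] c_b M_{a i₀}`. [folklore] -/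
theorem mul_rowClearMatrix_apply (M : Matrix (Fin n) (Fin n) F) (i₀ : Fin n) (c : Fin n → F)
    (a b : Fin n) :
    (M * rowClearMatrix i₀ c) a b = M a b - (if b < i₀ then c b * M a i₀ else 0) := by
  rw [Matrix.mul_apply]
  simp_rw [rowClearMatrix_apply, mul_add, Finset.sum_add_distrib]
  have h1 : ∑ l, M a l * (if l = b then (1 : F) else 0) = M a b := by
    simp_rw [mul_ite, mul_one, mul_zero]
    rw [Finset.sum_ite_eq' Finset.univ b, if_pos (Finset.mem_univ _)]
  have h2 : ∑ l, M a l * (if l = i₀ ∧ b < i₀ then -c b else 0) =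
      -(if b < i₀ then c b * M a i₀ else 0) := by
    by_cases hb : b < i₀
    · simp_rw [hb, and_true, if_true, mul_ite, mul_zero]
      rw [Finset.sum_ite_eq' Finset.univ i₀, if_pos (Finset.mem_univ _)]
      ring
    · simp [hb]
  rw [h1, h2, sub_eq_add_neg]

omit [ValuativeRel F] in
/-- `rowClearMatrix` is lower triangular. [folklore] -/
theorem blockTriangular_toDual_rowClearMatrix (i₀ : Fin n) (c : Fin n → F) :
    (rowClearMatrix i₀ c).BlockTriangular OrderDual.toDual := by
  intro a b hab
  have hab' : a < b := hab
  unfold rowClearMatrix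
  rw [if_neg hab'.ne, if_neg]
  rintro ⟨rfl, hb⟩
  exact absurd (hab'.trans hb) (lt_irrefl _)

omit [ValuativeRel F] in
/-- `det (rowClearMatrix i₀ c) = 1`. [folklore] -/
theorem det_rowClearMatrix (i₀ : Fin n) (c : Fin n → F) : (rowClearMatrix i₀ c).det = 1 := by
  rw [Matrix.det_of_lowerTriangular _ (blockTriangular_toDual_rowClearMatrix i₀ c)]
  exact Finset.prod_eq_one fun i _ => by simp [rowClearMatrix]

omit [ValuativeRel F] in
/-- `rowClearMatrix` as an element of `GL_n(F)`. [folklore] -/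
def rowClearGL (i₀ : Fin n) (c : Fin n → F) : GL (Fin n) F :=
  Matrix.GeneralLinearGroup.mkOfDetNeZero (rowClearMatrix i₀ c)
    (by rw [det_rowClearMatrix]; exact one_ne_zero)

omit [ValuativeRel F] in
/-- The matrix of `rowClearGL`. [folklore] -/
theorem coe_rowClearGL (i₀ : Fin n) (c : Fin n → F) :
    ((rowClearGL i₀ c : GL (Fin n) F) : Matrix (Fin n) (Fin n) F) = rowClearMatrix i₀ c := rfl

/-- `rowClearGL i₀ c ∈ GL_n(𝒪)` for integral `c`. [folklore] -/
theorem rowClearGL_mem_glInt (i₀ : Fin n) {c : Fin n → F} (hc : ∀ b, b < i₀ → c b ∈ 𝒪[F]) :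
    rowClearGL i₀ c ∈ glInt n F := by
  refine mem_glInt_of_isIntegralMatrix (fun a b => ?_) ?_
  · rw [coe_rowClearGL]
    unfold rowClearMatrix
    split_ifs with h1 h2
    · exact Subring.one_mem _
    · exact Subring.neg_mem _ (hc b h2.2)
    · exact Subring.zero_mem _
  · rw [coe_rowClearGL, det_rowClearMatrix, map_one]

/-! ### The elimination step -/

/-- **Elimination step.** If the rows `> i₀` of `g ∈ GL_n(F)` are upper triangular, there is
`k ∈ GL_n(𝒪)` (a column permutation followed by integral column operations) such that the rows
`≥ i₀` of `g k` are upper triangular: move an entry of maximal valuation among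
`g_{i₀ 0}, …, g_{i₀ i₀}` to the diagonal and clear the rest of the row with it.
[cite: Bump1997, Prop. 4.5.2 (proof)] -/
theorem exists_mul_glInt_isRowTriangularFrom (g : GL (Fin n) F) (i₀ : Fin n)
    (hg : IsRowTriangularFrom (g : Matrix (Fin n) (Fin n) F) (i₀ + 1)) :
    ∃ k ∈ glInt n F,
      IsRowTriangularFrom ((g * k : GL (Fin n) F) : Matrix (Fin n) (Fin n) F) i₀ := by
  classical
  set M : Matrix (Fin n) (Fin n) F := (g : Matrix (Fin n) (Fin n) F) with hM
  -- an entry of maximal valuation in the row `i₀`, columns `≤ i₀`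
  obtain ⟨j₀, hj₀, hmax⟩ := Finset.exists_max_image (Finset.Iic i₀)
    (fun j => valuation F (M i₀ j)) ⟨i₀, Finset.mem_Iic.mpr le_rfl⟩
  rw [Finset.mem_Iic] at hj₀
  set p : F := M i₀ j₀ with hp
  -- `p ≠ 0`, for otherwise `det g = 0`
  have hp0 : p ≠ 0 := by
    intro hp0
    apply (Matrix.GeneralLinearGroup.det_ne_zero g)
    refine det_eq_zero_of_rows_supported i₀ fun i j hi hj => ?_
    rcases hi.lt_or_eq with hlt | heq
    · exact hg i j (Nat.succ_le_of_lt (Fin.lt_def.mp hlt)) (lt_of_le_of_lt hj hlt)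
    · have := hmax j (Finset.mem_Iic.mpr hj)
      rw [hp0, map_zero, le_zero_iff, map_eq_zero] at this
      rw [← heq]
      exact this
  -- step 1: swap the columns `j₀` and `i₀`
  set σ : Equiv.Perm (Fin n) := Equiv.swap j₀ i₀ with hσ
  set g₁ : GL (Fin n) F := g * permGL σ with hg₁
  have hg₁_apply : ∀ a b, (g₁ : Matrix (Fin n) (Fin n) F) a b = M a (σ b) := by
    intro a b
    rw [hg₁, Units.val_mul, coe_permGL, mul_permMatrix_apply, hσ, Equiv.symm_swap]
  have hg₁_diag : (g₁ : Matrix (Fin n) (Fin n) F) i₀ i₀ = p := by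
    rw [hg₁_apply, hσ, Equiv.swap_apply_right]
  have hg₁_max : ∀ b, b ≤ i₀ → valuation F ((g₁ : Matrix (Fin n) (Fin n) F) i₀ b) ≤
      valuation F p := by
    intro b hb
    rw [hg₁_apply]
    refine hmax (σ b) (Finset.mem_Iic.mpr ?_)
    rw [hσ]
    rcases eq_or_ne b j₀ with rfl | hbj
    · rw [Equiv.swap_apply_left]
    rcases eq_or_ne b i₀ with rfl | hbi
    · rw [Equiv.swap_apply_right]; exact hj₀
    · rw [Equiv.swap_apply_of_ne_of_ne hbj hbi]; exact hb
  have hg₁_tri : IsRowTriangularFrom (g₁ : Matrix (Fin n) (Fin n) F) (i₀ + 1) := by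
    intro i j hi hj
    rw [hg₁_apply]
    have hi' : i₀ < i := Fin.lt_def.mpr (Nat.lt_of_succ_le hi)
    refine hg i (σ j) hi ?_
    rw [hσ]
    rcases eq_or_ne j j₀ with rfl | hjj
    · rw [Equiv.swap_apply_left]; exact hi'
    rcases eq_or_ne j i₀ with rfl | hji
    · rw [Equiv.swap_apply_right]; exact lt_of_le_of_lt hj₀ hi'
    · rw [Equiv.swap_apply_of_ne_of_ne hjj hji]; exact hj
  -- step 2: clear the row `i₀` to the left of the diagonal
  set c : Fin n → F := fun b => (g₁ : Matrix (Fin n) (Fin n) F) i₀ b / p with hc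
  have hc_mem : ∀ b, b < i₀ → c b ∈ 𝒪[F] := by
    intro b hb
    rw [Valuation.mem_integer_iff, hc]
    dsimp only
    rw [map_div₀]
    have hvp : 0 < valuation F p := by
      rw [zero_lt_iff, ne_eq, map_eq_zero]; exact hp0
    rw [div_le_one₀ hvp]
    exact hg₁_max b hb.le
  refine ⟨permGL σ * rowClearGL i₀ c, Subgroup.mul_mem _ (permGL_mem_glInt σ)
    (rowClearGL_mem_glInt i₀ hc_mem), ?_⟩
  intro i j hi hj
  rw [← mul_assoc, ← hg₁, Units.val_mul, coe_rowClearGL, mul_rowClearMatrix_apply]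
  rcases (Nat.le_iff_lt_or_eq.mp hi) with hlt | heq
  · -- rows `> i₀` stay triangular
    have hlt' : i₀ < i := Fin.lt_def.mpr hlt
    rw [hg₁_tri i j (Nat.succ_le_of_lt hlt) hj,
      hg₁_tri i i₀ (Nat.succ_le_of_lt hlt) hlt']
    simp
  · -- the row `i₀`
    have hi0 : i = i₀ := (Fin.ext heq).symm
    subst hi0
    rw [if_pos hj, hg₁_diag, hc]
    dsimp only
    rw [div_mul_cancel₀ _ hp0, sub_self]

/-! ### The Iwasawa decomposition -/

/-- For every `g ∈ GL_n(F)` and `m`, if the rows `≥ m` of `g` are upper triangular then some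
`g k`, `k ∈ GL_n(𝒪)`, is upper triangular (induction on `m` with the elimination step).
[folklore] -/
theorem exists_mul_glInt_blockTriangular_of_isRowTriangularFrom (m : ℕ) :
    ∀ g : GL (Fin n) F, IsRowTriangularFrom (g : Matrix (Fin n) (Fin n) F) m →
      ∃ k ∈ glInt n F, ((g * k : GL (Fin n) F) : Matrix (Fin n) (Fin n) F).BlockTriangular id := by
  induction m with
  | zero =>
    intro g hg
    exact ⟨1, Subgroup.one_mem _, by rw [mul_one]; exact isRowTriangularFrom_zero_iff.mp hg⟩
  | succ m ih =>
    intro g hg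
    by_cases hm : m < n
    · obtain ⟨k, hk, hgk⟩ := exists_mul_glInt_isRowTriangularFrom g ⟨m, hm⟩ hg
      obtain ⟨k', hk', h'⟩ := ih (g * k) hgk
      exact ⟨k * k', Subgroup.mul_mem _ hk hk', by rw [← mul_assoc]; exact h'⟩
    · exact ih g (isRowTriangularFrom_of_le (not_lt.mp hm))

/-- **Iwasawa decomposition, first form**: every `g ∈ GL_n(F)` is `g = b k` with `b` upper
triangular invertible (`b ∈ P_id = B(F)`, `standardParabolicGL F id`) and `k ∈ GL_n(𝒪)`; here
`𝒪` is the valuation ring of any valuative relation on the field `F`.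
[cite: Bump1997, Prop. 4.5.2] -/
theorem exists_borel_mul_glInt (g : GL (Fin n) F) :
    ∃ b ∈ standardParabolicGL F (id : Fin n → Fin n), ∃ k ∈ glInt n F, g = b * k := by
  obtain ⟨k, hk, hgk⟩ := exists_mul_glInt_blockTriangular_of_isRowTriangularFrom n g
    (isRowTriangularFrom_of_le le_rfl)
  exact ⟨g * k, hgk, k⁻¹, Subgroup.inv_mem _ hk, by rw [mul_assoc, mul_inv_cancel, mul_one]⟩

end Literature.NumberTheory.Automorphic

/-! ## The refined decomposition `GL_n(F) = U · ϖ^{ℤⁿ} · GL_n(𝒪)` and uniqueness of the exponents -/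

namespace Literature.NumberTheory.Automorphic

open ValuativeRel Matrix Finset Echelon

variable {F : Type*} [Field F] [ValuativeRel F] {n : ℕ}

/-! ### Upper triangular invertible matrices: diagonal part -/

omit [ValuativeRel F] in
/-- The diagonal entries of an invertible upper triangular matrix are non-zero. [folklore] -/
theorem apply_self_ne_zero_of_blockTriangular (b : GL (Fin n) F)
    (hb : (b : Matrix (Fin n) (Fin n) F).BlockTriangular id) (i : Fin n) :
    (b : Matrix (Fin n) (Fin n) F) i i ≠ 0 := by
  have hdet := Matrix.GeneralLinearGroup.det_ne_zero b
  rw [Matrix.det_of_upperTriangular hb] at hdet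
  exact (Finset.prod_ne_zero_iff.mp hdet) i (Finset.mem_univ i)

omit [ValuativeRel F] in
/-- The diagonal part `diag(b_{ii})` of an invertible upper triangular matrix, as units.
[folklore] -/
def diagPart (b : GL (Fin n) F) (hb : (b : Matrix (Fin n) (Fin n) F).BlockTriangular id) :
    Fin n → Fˣ :=
  fun i => Units.mk0 _ (apply_self_ne_zero_of_blockTriangular b hb i)

omit [ValuativeRel F] in
/-- `diagPart b` has the diagonal entries of `b` as values. [folklore] -/
theorem coe_diagPart (b : GL (Fin n) F) (hb : (b : Matrix (Fin n) (Fin n) F).BlockTriangular id)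
    (i : Fin n) : (diagPart b hb i : F) = (b : Matrix (Fin n) (Fin n) F) i i := rfl

omit [ValuativeRel F] in
/-- On upper triangular matrices the diagonal is multiplicative: `(M N)_{ii} = M_{ii} N_{ii}`.
[folklore] -/
theorem _root_.Matrix.BlockTriangular.mul_apply_self {M N : Matrix (Fin n) (Fin n) F}
    (hM : M.BlockTriangular id) (hN : N.BlockTriangular id) (i : Fin n) :
    (M * N) i i = M i i * N i i := by
  rw [Matrix.mul_apply, Finset.sum_eq_single i]
  · intro l _ hl
    rcases lt_or_gt_of_ne hl with h | h
    · rw [hM h, zero_mul]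
    · rw [hN h, mul_zero]
  · intro h; exact absurd (Finset.mem_univ i) h

omit [ValuativeRel F] in
/-- `b · diag(b_{ii})⁻¹` is upper unitriangular for `b` invertible upper triangular:
`B = U · A`. [folklore] -/
theorem mul_diagonalGL_inv_mem_upperUnitriangular (b : GL (Fin n) F)
    (hb : (b : Matrix (Fin n) (Fin n) F).BlockTriangular id) :
    b * (diagonalGL (Fin n) F (diagPart b hb))⁻¹ ∈ upperUnitriangular (Fin n) F := by
  rw [mem_upperUnitriangular_iff, ← map_inv, Units.val_mul, coe_diagonalGL]
  refine ⟨hb.mul (Matrix.blockTriangular_diagonal _), fun i => ?_⟩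
  rw [Matrix.mul_diagonal, Pi.inv_apply, Units.val_inv_eq_inv_val, coe_diagPart,
    mul_inv_cancel₀ (apply_self_ne_zero_of_blockTriangular b hb i)]

/-- **Iwasawa decomposition, `U A K` form**: `g = u · diag(d) · k` with `u` upper unitriangular,
`d ∈ (Fˣ)ⁿ` and `k ∈ GL_n(𝒪)`. [cite: Bump1997, Prop. 4.5.2] -/
theorem exists_unipotent_mul_diagonal_mul_glInt (g : GL (Fin n) F) :
    ∃ u ∈ upperUnitriangular (Fin n) F, ∃ d : Fin n → Fˣ, ∃ k ∈ glInt n F,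
      g = u * diagonalGL (Fin n) F d * k := by
  obtain ⟨b, hb, k, hk, rfl⟩ := exists_borel_mul_glInt g
  refine ⟨b * (diagonalGL (Fin n) F (diagPart b hb))⁻¹,
    mul_diagonalGL_inv_mem_upperUnitriangular b hb, diagPart b hb, k, hk, ?_⟩
  rw [inv_mul_cancel_right]

/-! ### Diagonal units and `ϖ`-powers -/

/-- A diagonal matrix with entries of valuation `1` lies in `GL_n(𝒪)`. [folklore] -/
theorem diagonalGL_mem_glInt {e : Fin n → Fˣ} (he : ∀ i, valuation F (e i : F) = 1) :
    diagonalGL (Fin n) F e ∈ glInt n F := by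
  refine mem_glInt_of_isIntegralMatrix (fun i j => ?_) ?_
  · rw [coe_diagonalGL, Matrix.diagonal_apply]
    split_ifs
    · exact (Valuation.mem_integer_iff _ _).mpr (he i).le
    · exact Subring.zero_mem _
  · rw [coe_diagonalGL, Matrix.det_diagonal, map_prod]
    exact Finset.prod_eq_one fun i _ => he i

/-- The torus element `ϖ^m = diag(ϖ^{m_1}, …, ϖ^{m_n})`, `m ∈ ℤⁿ`, for `ϖ ≠ 0`. [folklore] -/
def zpowDiagGL {ϖ : F} (hϖ : ϖ ≠ 0) (m : Fin n → ℤ) : GL (Fin n) F :=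
  diagonalGL (Fin n) F (fun i => Units.mk0 ϖ hϖ ^ m i)

omit [ValuativeRel F] in
/-- The matrix of `ϖ^m` is `diag(ϖ^{m_i})`. [folklore] -/
theorem coe_zpowDiagGL {ϖ : F} (hϖ : ϖ ≠ 0) (m : Fin n → ℤ) :
    ((zpowDiagGL hϖ m : GL (Fin n) F) : Matrix (Fin n) (Fin n) F) =
      Matrix.diagonal fun i => ϖ ^ m i := by
  rw [zpowDiagGL, coe_diagonalGL]
  congr 1
  funext i
  rw [Units.val_zpow_eq_zpow_val, Units.val_mk0]

omit [ValuativeRel F] in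
/-- `ϖ^m` for `m ∈ ℕⁿ` is `piPowGL` of `HeckeTransversalGL`. [folklore] -/
theorem zpowDiagGL_natCast {ϖ : F} (hϖ : ϖ ≠ 0) (m : Fin n → ℕ) :
    zpowDiagGL hϖ (fun i => (m i : ℤ)) = piPowGL hϖ m := by
  refine Units.ext ?_
  rw [coe_zpowDiagGL, coe_piPowGL]
  unfold piPow
  congr 1
  funext i
  rw [zpow_natCast]

omit [ValuativeRel F] in
/-- `ϖ^{m + m'} = ϖ^m ϖ^{m'}`. [folklore] -/
theorem zpowDiagGL_add {ϖ : F} (hϖ : ϖ ≠ 0) (m m' : Fin n → ℤ) :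
    zpowDiagGL hϖ (m + m') = zpowDiagGL hϖ m * zpowDiagGL hϖ m' := by
  rw [zpowDiagGL, zpowDiagGL, zpowDiagGL, ← map_mul]
  congr 1
  funext i
  rw [Pi.mul_apply, Pi.add_apply, _root_.zpow_add]

omit [ValuativeRel F] in
/-- `ϖ^0 = 1`. [folklore] -/
theorem zpowDiagGL_zero {ϖ : F} (hϖ : ϖ ≠ 0) : zpowDiagGL hϖ (0 : Fin n → ℤ) = 1 := by
  rw [zpowDiagGL]
  have : (fun i : Fin n => Units.mk0 ϖ hϖ ^ (0 : Fin n → ℤ) i) = 1 := funext fun i => by simp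
  rw [this, map_one]

omit [ValuativeRel F] in
/-- `ϖ^{-m} = (ϖ^m)⁻¹`. [folklore] -/
theorem zpowDiagGL_neg {ϖ : F} (hϖ : ϖ ≠ 0) (m : Fin n → ℤ) :
    zpowDiagGL hϖ (-m) = (zpowDiagGL hϖ m)⁻¹ := by
  rw [eq_inv_iff_mul_eq_one, ← zpowDiagGL_add, neg_add_cancel, zpowDiagGL_zero]

omit [ValuativeRel F] in
/-- The blocks of `ϖ^m` are upper triangular (it is diagonal). [folklore] -/
theorem blockTriangular_zpowDiagGL {ϖ : F} (hϖ : ϖ ≠ 0) (m : Fin n → ℤ) :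
    ((zpowDiagGL hϖ m : GL (Fin n) F) : Matrix (Fin n) (Fin n) F).BlockTriangular id := by
  rw [coe_zpowDiagGL]; exact Matrix.blockTriangular_diagonal _

/-- In a field whose valuation ring is a discrete valuation ring with uniformizing element `ϖ`
(e.g. a non-archimedean local field), every `x ≠ 0` is `ϖ^a · e` with `|e| = 1`. [folklore] -/
theorem exists_eq_zpow_mul_of_ne_zero [IsDiscreteValuationRing 𝒪[F]] {ϖ : F}
    (hϖ : IsUniformizingElement ϖ) {x : F} (hx : x ≠ 0) :
    ∃ (a : ℤ) (e : F), valuation F e = 1 ∧ x = ϖ ^ a * e := by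
  have hirr : Irreducible (⟨ϖ, hϖ.mem⟩ : 𝒪[F]) :=
    (IsDiscreteValuationRing.irreducible_iff_uniformizer _).mpr hϖ.span_eq
  have hunit : ∀ u : (𝒪[F])ˣ, valuation F ((u : 𝒪[F]) : F) = 1 := fun u =>
    (Valuation.integer.integers (valuation F)).isUnit_iff_valuation_eq_one.mp u.isUnit
  by_cases hxO : x ∈ 𝒪[F]
  · have hx' : (⟨x, hxO⟩ : 𝒪[F]) ≠ 0 := fun h => hx (congrArg Subtype.val h)
    obtain ⟨k, u, hu⟩ := IsDiscreteValuationRing.eq_unit_mul_pow_irreducible hx' hirr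
    refine ⟨k, (u : 𝒪[F]), hunit u, ?_⟩
    have := congrArg Subtype.val hu
    simp only [Subring.coe_mul, Subring.coe_pow] at this
    rw [zpow_natCast, mul_comm]
    exact this
  · -- `x⁻¹ ∈ 𝒪`
    have hxinv : x⁻¹ ∈ 𝒪[F] := by
      rw [Valuation.mem_integer_iff, map_inv₀]
      rw [Valuation.mem_integer_iff, not_le] at hxO
      exact (inv_lt_one₀ (lt_trans zero_lt_one hxO)).mpr hxO |>.le
    have hx' : (⟨x⁻¹, hxinv⟩ : 𝒪[F]) ≠ 0 := fun h => inv_ne_zero hx (congrArg Subtype.val h)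
    obtain ⟨k, u, hu⟩ := IsDiscreteValuationRing.eq_unit_mul_pow_irreducible hx' hirr
    refine ⟨-(k : ℤ), ((u⁻¹ : (𝒪[F])ˣ) : 𝒪[F]), hunit u⁻¹, ?_⟩
    have h1 := congrArg Subtype.val hu
    simp only [Subring.coe_mul, Subring.coe_pow] at h1
    -- `x⁻¹ = u ϖ^k`, so `x = ϖ^{-k} u⁻¹`
    have huinv : (((u⁻¹ : (𝒪[F])ˣ) : 𝒪[F]) : F) = (((u : 𝒪[F]) : F))⁻¹ := by
      symm
      apply inv_eq_of_mul_eq_one_left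
      exact_mod_cast congrArg Subtype.val (Units.inv_mul u)
    rw [huinv, _root_.zpow_neg, zpow_natCast, ← mul_inv, mul_comm, ← h1, inv_inv]

/-- **Iwasawa decomposition, `U ϖ^{ℤⁿ} K` form**: if the valuation ring is a discrete valuation
ring with uniformizing element `ϖ` then every `g ∈ GL_n(F)` is `g = u ϖ^m k` with `u` upper
unitriangular, `m ∈ ℤⁿ` and `k ∈ GL_n(𝒪)`. [cite: Bump1997, Prop. 4.5.2] -/
theorem exists_unipotent_mul_zpowDiagGL_mul_glInt [IsDiscreteValuationRing 𝒪[F]] {ϖ : F}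
    (hϖ : IsUniformizingElement ϖ) (g : GL (Fin n) F) :
    ∃ u ∈ upperUnitriangular (Fin n) F, ∃ m : Fin n → ℤ, ∃ k ∈ glInt n F,
      g = u * zpowDiagGL hϖ.ne_zero m * k := by
  obtain ⟨u, hu, d, k, hk, rfl⟩ := exists_unipotent_mul_diagonal_mul_glInt g
  choose a e he hde using fun i => exists_eq_zpow_mul_of_ne_zero hϖ (d i).ne_zero
  have he0 : ∀ i, e i ≠ 0 := by
    intro i h; have := he i; rw [h, map_zero] at this; exact zero_ne_one this
  set e' : Fin n → Fˣ := fun i => Units.mk0 (e i) (he0 i) with he'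
  have hd : diagonalGL (Fin n) F d = zpowDiagGL hϖ.ne_zero a * diagonalGL (Fin n) F e' := by
    rw [zpowDiagGL, ← map_mul]
    congr 1
    funext i
    refine Units.ext ?_
    rw [Pi.mul_apply, Units.val_mul, Units.val_zpow_eq_zpow_val, Units.val_mk0, he', Units.val_mk0]
    exact hde i
  refine ⟨u, hu, a, diagonalGL (Fin n) F e' * k,
    Subgroup.mul_mem _ (diagonalGL_mem_glInt fun i => he i) hk, ?_⟩
  rw [hd]; group

/-! ### Uniqueness of the exponents -/

/-- If `ϖ^d ∈ 𝒪` and `ϖ^{-d} ∈ 𝒪` (`d ∈ ℤ`) then `d = 0`. [folklore] -/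
theorem IsUniformizingElement.eq_zero_of_zpow_mem {ϖ : F} (hϖ : IsUniformizingElement ϖ) {d : ℤ}
    (h₁ : ϖ ^ d ∈ 𝒪[F]) (h₂ : ϖ ^ (-d) ∈ 𝒪[F]) : d = 0 := by
  by_contra hd
  -- reduce to `d < 0`
  wlog hneg : d < 0 generalizing d
  · exact this (d := -d) h₂ (by rwa [neg_neg]) (neg_ne_zero.mpr hd) (by omega)
  apply hϖ.inv_not_mem
  have : ϖ⁻¹ = ϖ ^ d * ϖ ^ ((-d - 1).toNat) := by
    rw [← zpow_natCast, Int.toNat_of_nonneg (by omega), ← zpow_add₀ hϖ.ne_zero]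
    rw [show d + (-d - 1) = -1 by ring, _root_.zpow_neg_one]
  rw [this]
  exact Subring.mul_mem _ h₁ (hϖ.pow_mem _)

omit [ValuativeRel F] in
/-- Entries of elements of `U_n`: upper triangular. [folklore] -/
theorem blockTriangular_of_mem_upperUnitriangular {u : GL (Fin n) F}
    (hu : u ∈ upperUnitriangular (Fin n) F) :
    ((u : GL (Fin n) F) : Matrix (Fin n) (Fin n) F).BlockTriangular id :=
  ((mem_upperUnitriangular_iff u).mp hu).1

omit [ValuativeRel F] in
/-- Diagonal entries of elements of `U_n` are `1`. [folklore] -/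
theorem apply_self_of_mem_upperUnitriangular {u : GL (Fin n) F}
    (hu : u ∈ upperUnitriangular (Fin n) F) (i : Fin n) :
    ((u : GL (Fin n) F) : Matrix (Fin n) (Fin n) F) i i = 1 :=
  ((mem_upperUnitriangular_iff u).mp hu).2 i

omit [ValuativeRel F] in
/-- The diagonal of `(ϖ^m)⁻¹ v ϖ^{m'}` for `v ∈ U_n` is `ϖ^{m'_i - m_i}`. [folklore] -/
theorem zpowDiagGL_inv_mul_mul_zpowDiagGL_apply_self {ϖ : F} (hϖ : ϖ ≠ 0) (m m' : Fin n → ℤ)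
    {v : GL (Fin n) F} (hv : v ∈ upperUnitriangular (Fin n) F) (i : Fin n) :
    (((zpowDiagGL hϖ m)⁻¹ * v * zpowDiagGL hϖ m' : GL (Fin n) F) : Matrix (Fin n) (Fin n) F) i i =
      ϖ ^ (m' i - m i) := by
  rw [← zpowDiagGL_neg, Units.val_mul, Units.val_mul, coe_zpowDiagGL, coe_zpowDiagGL,
    Matrix.mul_diagonal, Matrix.diagonal_mul, apply_self_of_mem_upperUnitriangular hv, mul_one,
    Pi.neg_apply, ← zpow_add₀ hϖ]
  congr 1; ring

/-- **Uniqueness of the torus part**: if `u ϖ^m k = u' ϖ^{m'} k'` with `u, u' ∈ U_n` and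
`k, k' ∈ GL_n(𝒪)` then `m = m'` (the diagonal of the upper triangular matrix
`(u ϖ^m)⁻¹ (u' ϖ^{m'}) = k k'⁻¹ ∈ GL_n(𝒪)` and of its inverse must be integral). [folklore] -/
theorem zpowDiagGL_unique {ϖ : F} (hϖ : IsUniformizingElement ϖ) {u u' : GL (Fin n) F}
    (hu : u ∈ upperUnitriangular (Fin n) F) (hu' : u' ∈ upperUnitriangular (Fin n) F)
    {m m' : Fin n → ℤ} {k k' : GL (Fin n) F} (hk : k ∈ glInt n F) (hk' : k' ∈ glInt n F)
    (h : u * zpowDiagGL hϖ.ne_zero m * k = u' * zpowDiagGL hϖ.ne_zero m' * k') : m = m' := by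
  -- `x = (u ϖ^m)⁻¹ (u' ϖ^{m'}) = k k'⁻¹ ∈ K₀`
  set x : GL (Fin n) F := (zpowDiagGL hϖ.ne_zero m)⁻¹ * (u⁻¹ * u') * zpowDiagGL hϖ.ne_zero m'
    with hx
  have hxk : x = k * k'⁻¹ := by
    rw [hx]
    have : u' * zpowDiagGL hϖ.ne_zero m' = u * zpowDiagGL hϖ.ne_zero m * k * k'⁻¹ := by
      rw [h, mul_inv_cancel_right]
    calc (zpowDiagGL hϖ.ne_zero m)⁻¹ * (u⁻¹ * u') * zpowDiagGL hϖ.ne_zero m'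
        = (zpowDiagGL hϖ.ne_zero m)⁻¹ * u⁻¹ * (u' * zpowDiagGL hϖ.ne_zero m') := by group
      _ = k * k'⁻¹ := by rw [this]; group
  have hxK : x ∈ glInt n F := hxk ▸ Subgroup.mul_mem _ hk (Subgroup.inv_mem _ hk')
  have hv : u⁻¹ * u' ∈ upperUnitriangular (Fin n) F :=
    Subgroup.mul_mem _ (Subgroup.inv_mem _ hu) hu'
  have hv' : u'⁻¹ * u ∈ upperUnitriangular (Fin n) F :=
    Subgroup.mul_mem _ (Subgroup.inv_mem _ hu') hu
  funext i
  -- diagonal entries of `x` and `x⁻¹`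
  have h1 : (x : Matrix (Fin n) (Fin n) F) i i = ϖ ^ (m' i - m i) :=
    zpowDiagGL_inv_mul_mul_zpowDiagGL_apply_self hϖ.ne_zero m m' hv i
  have hxinv : x⁻¹ = (zpowDiagGL hϖ.ne_zero m')⁻¹ * (u'⁻¹ * u) * zpowDiagGL hϖ.ne_zero m := by
    rw [hx]; group
  have h2 : ((x⁻¹ : GL (Fin n) F) : Matrix (Fin n) (Fin n) F) i i = ϖ ^ (m i - m' i) := by
    rw [hxinv]; exact zpowDiagGL_inv_mul_mul_zpowDiagGL_apply_self hϖ.ne_zero m' m hv' i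
  have hint₁ := isIntegralMatrix_of_mem_glInt hxK i i
  have hint₂ := isIntegralMatrix_inv_of_mem_glInt hxK i i
  rw [h1] at hint₁
  rw [h2, show m i - m' i = -(m' i - m i) by ring] at hint₂
  have := hϖ.eq_zero_of_zpow_mem hint₁ hint₂
  omega

end Literature.NumberTheory.Automorphic
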